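import Summits.ResolutionOfSingularities.ResolutionOfSingularities.Theorems.MarkedTransferCampaignW46ThreefoldsTauTwoSlice
import Literature.AlgebraicGeometry.Resolution.AlterationsNormalFormCentreFormalIdeal
import Literature.AlgebraicGeometry.Resolution.WeakJacobianMizutaniProof
import HarnessLib

/-!
# [OURS · L1 W4.6 rung (ii-τ2)] THE ISOLATED `τ ≥ 2` SLICE FOR SCHEMES OF FINITE TYPE OVER A FIELD — the G-ring hypothesis
# DISCHARGED (Matsumura, Cor. of Thm. 32.6, proved in the tree)

Cell res-hironaka, LADDER-RESOLUTION rung L (D-0089), slot W4.6, rung (ii) (threefold hypersurfaces); seat res-L1-s46-pv-3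
(gen 4). Host route MarkedTransfer, host item `HypersurfaceOrderReductionDimLeThree` (stmt-ResolutionOfSingularities-16156);
filed `--kind proof --supports` it `--as helper`. Leaf of `…ThreefoldsTauTwoSlice.lean` (p515229): there the isolated `τ ≥ 2`
slice `orderReducible_of_finite_two_le_tau` carries the hypothesis «`𝒪_{X,x}` is a G-ring at the bad points» (the completion
step of Cossart–Piltant's termination argument). For schemes locally of finite type over a field this hypothesis HOLDS — the
tree proves Matsumura's «finitely generated algebras over a field are G-rings» (`Matsumura1987_32_polynomial_holds`,
`isGRing_stalk_of_polynomial`) — so in the binders of the Γ-free ladder (`X` of finite type over a perfect field) the slice is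
UNCONDITIONAL. Nothing of H. Hironaka's manuscript is asserted. AI-written; AI review is weaker than expert review.

## What is proved (no definitions)

* `CampaignW46.orderReducible_of_finite_two_le_tau_of_locallyOfFiniteType` — the isolated `τ ≥ 2` slice for `X` regular and
  locally of finite type over a field: NO G-ring hypothesis.
* `CampaignW46.gammaFreeGlobalDimLE_isolated_two_le_tau_slice (p d)` — the slice in the binders of the ladder
  `GammaFreeGlobalOrderReductionDimLE p d` (any `d`; statement of record `d = 3`): binders + «the points of order `≥ m` form a
  finite set of closed points with `ord = m`, embedding dimension `3`, `τ ≥ 2`» ⇒ `OrderReducible I m`.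

References: `…ThreefoldsTauTwoSlice.lean` (p515229), tree `Resolution/AlterationsNormalFormCentreFormalIdeal.lean`
(`isGRing_stalk_of_polynomial`), `Resolution/WeakJacobianMizutaniProof.lean` (`Matsumura1987_32_polynomial_holds`
[Matsumura1987, §32, Cor. of Thm. 32.6]), `Resolution/NearChainTermination.lean` [CossartPiltant2008, proof of Prop. 4.4].
H. Hironaka, ms. 2017-03-23 — scope only, under adjudication, not cited as fact. [Hironaka2017]
-/

noncomputable section

set_option linter.dupNamespace false -- mandated namespace of this single-conjunct summit

open CategoryTheory AlgebraicGeometry TopologicalSpace IsLocalRing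

namespace Summit.ResolutionOfSingularities.ResolutionOfSingularities.Theorems

namespace CampaignW46

open Literature.AlgebraicGeometry.Resolution
open Scheme.IdealSheafData

universe u

/-- **THE ISOLATED `τ ≥ 2` SLICE, FINITE TYPE OVER A FIELD — NO G-RING HYPOTHESIS.** `X` regular and locally of finite type
over a field `k`, `J`, `m ≥ 1`; if the points of order `≥ m` form a finite set `S` of closed points with `ord = m`, embedding
dimension `3` and Hironaka `τ ≥ 2` at each, then `(X, J, m)` is order-reducible (by point blow-ups). The local rings of `X` are
G-rings by Matsumura's Corollary of Thm. 32.6 (tree). [cite: CossartPiltant2008, Prop. 4.4; Matsumura1987, §32] -/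
theorem orderReducible_of_finite_two_le_tau_of_locallyOfFiniteType {k : Type u} [Field k] {X : Scheme.{u}}
    (s : X ⟶ Spec (.of k)) [LocallyOfFiniteType s] (hX : Scheme.IsRegular X) (J : X.IdealSheafData) {m : ℕ}
    (hm : 1 ≤ m) (S : Set X) (hS : S.Finite) (hSc : ∀ x ∈ S, IsClosed ({x} : Set X))
    (hJS : ∀ x : X, (m : ℕ∞) ≤ idealOrder J x → x ∈ S) (hord : ∀ x ∈ S, idealOrder J x = m)
    (hdim : ∀ x ∈ S, (maximalIdeal (X.presheaf.stalk x)).spanFinrank = 3)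
    (hτ : ∀ x ∈ S, haveI := hX x; 2 ≤ stalkTau J x m) : OrderReducible J m := by
  haveI : IsLocallyNoetherian X := LocallyOfFiniteType.isLocallyNoetherian s
  exact orderReducible_of_finite_two_le_tau hX J hm S hS hSc hJS hord hdim hτ fun x _ =>
    isGRing_stalk_of_polynomial Matsumura1987_32_polynomial_holds s x

/-- **THE ISOLATED `τ ≥ 2` SLICE OF EVERY RUNG OF THE Γ-FREE LADDER, UNCONDITIONALLY** (`GammaFreeGlobalOrderReductionDimLE p d`,
p496755): its binders, plus «the points of order `≥ m` form a finite set of closed points, each of order exactly `m`, embedding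
dimension `3` and `τ ≥ 2`», give `OrderReducible I m` — at every `d`, in particular for the statement of record `d = 3`.
[cite: CossartPiltant2008, Prop. 4.4; Matsumura1987, §32] -/
theorem gammaFreeGlobalDimLE_isolated_two_le_tau_slice (p d : ℕ) :
    p.Prime → ∀ (k : Type u) [Field k] [CharP k p] [PerfectField k] (X : Scheme.{u}) (s : X ⟶ Spec (.of k)),
      IsSeparated s → LocallyOfFiniteType s → QuasiCompact s → IsIntegral X → ∀ (hreg : Scheme.IsRegular X),
        topologicalKrullDim X ≤ d → ∀ (I : X.IdealSheafData), I ≠ ⊥ → IsEffectiveCartier I → ∀ (m : ℕ), 1 ≤ m →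
          ∀ (S : Set X), S.Finite → (∀ x ∈ S, IsClosed ({x} : Set X)) →
            (∀ x : X, (m : ℕ∞) ≤ idealOrder I x → x ∈ S) → (∀ x ∈ S, idealOrder I x = m) →
              (∀ x ∈ S, (maximalIdeal (X.presheaf.stalk x)).spanFinrank = 3) →
                (∀ x ∈ S, haveI := hreg x; 2 ≤ stalkTau I x m) → OrderReducible I m := by
  intro _ k _ _ _ X s _ hloft _ _ hreg _ I _ _ m hm S hS hSc hJS hord hdim hτ
  exact orderReducible_of_finite_two_le_tau_of_locallyOfFiniteType s hreg I hm S hS hSc hJS hord hdim hτ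

end CampaignW46

end Summit.ResolutionOfSingularities.ResolutionOfSingularities.Theorems

end
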